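import Literature.MathematicalPhysics.QuantumFieldTheory.Balaban1983to89.B15RPrime1100OfRep
import Literature.MathematicalPhysics.QuantumFieldTheory.Balaban1983to89.Node00.Record11Carriers

/-!
# `Balaban1983to89.B15RPrime1100AtRecord` — YM-DAG node N12 · [Balaban1989LargeFieldI] CMP **122** (1989) 175–202, (1.99)–(1.102) pp. 200–201 at NODE 00's
# records ₁₀ ∕ ₁₁ with the [IV] bundle pinned (`Node00.CarriersW`, `Node00.Record11Carriers`): THE (1.100) DATA OF THE RESIDUAL [IV] LAYER `ResidW` PINNED to the
# 𝐑-step's own (1.100)-reading (`B15RPrime1100OfRep.rPrimeDataOfSel` at `Tstep rep_k` of the tower of record), so that the displayed hypothesis `h1102` of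
# `Node00.WDisplays₁₀` — [IV] (1.102) for the residual 𝐑′-data — and its three structural companions `hm ∕ h0 ∕ hC` are THEOREMS OF THE RECORD'S OWN `rstep` PROVISO
# (`Stage9Params.Provisos₁₀.rstep`, support form (R-C2)); N12's displayed [IV] statements at the pinned layer: Proposition 1 (1.78), (1.80), (1.89) + positive mass

statement-level bookkeeping over published theorems with citation tags; kernel-checked compositions of tree theorems; nothing here is a claim about the Yang–Mills
mass gap.

CITATION HEADER (lean-in-tree rule).  Source: [Balaban1989LargeFieldI] («[IV]»): (0.2)–(0.4) p. 176, Proposition 1 (1.78) p. 194, (1.80) p. 195, (1.89) p. 198, (1.99)–(1.102)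
pp. 200–201; record dictionaries [Balaban1988Convergent] (2.18) p. 257, (3.25) p. 270, [Balaban1989LargeFieldII] Thm 1 + (0.1) pp. 355–356.  Seat `pub-ymgap-dag-n12-e`
(YM-PLAN Track A, HUMAN RULING D-0062; director-ym R134 row N12 s3), module 2.  BY NAME and UNCHANGED: node00-def g30 ∕ g31's `Node00.CarriersW` (`ResidW`, `WOfRecord₁₀`,
`WDisplays₁₀`, `b15Leaf_WOfRecord₁₀_of_displays`, `IsRecordOfRecord₁₀CB10YZW`, `b15_main_of_isRecordOfRecord₁₀CB10YZW_of_displays`) and `Node00.Record11Carriers`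
(`IsRecordOfRecord₁₁CB10YZW`, `WOfRecord₁₁`, `upOfRecord₅C_view₁₁B10YZW_leaves`), def-T's `Node00.Record10` (`Stage9Params.Provisos₁₀`, field `rstep`), def-R's
`Node00.RStepSlotOfRecord` (`toRepData_towerRepOfRecord_eq`, `rfl`) and `Node00.RStepRepr218` (`repDataOfSel`, `rterm`), def-T's `Node00.RepTowerOfRecord` (`repTOfRecord9`,
`trhoOfRecord9`), module 1 `B15RPrime1100OfRep` (`rPrimeDataOfSel`, `normalization1102_trhoOfRecord9_rPrimeDataOfSel`).

WHY THIS FILE.  At a record of `IsRecordOfRecord₁₀CB10YZW` ∕ `₁₁CB10YZW` the `rBasicStep` leaf IS `B15Leaf (WOfRecord₁₀ θ λ P)` and follows from the DISPLAYS `WDisplays₁₀ θ λ P`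
(node00-def g30): the pre-𝐑 terms `t_s` of `Tstep rep_k`, `k := λ.kSel P`, measurable ∕ ≥ 0 ∕ bounded ∕ of positive mass, and the four printed statements Proposition 1
(1.78) on `λ.LF P`, (1.80) ∕ (1.89) on `λ.D189 P`, (1.102) for `λ.D1100 P` at `𝐓ρ_k`.  Two observations typed here: (i) the record ALREADY CARRIES def-R's support-form
provisos of exactly those terms — `Provisos₁₀.rstep P k hk` is, through def-R's `rfl` bridge `toRepData_towerRepOfRecord_eq`, `(repDataOfSel (Tstep rep_k) (ppSel … (k+1))
(fibOfSeq … (k+1))).ProvisosSupp` — so `hm ∕ h0 ∕ hC` are theorems once `kSel P < P.K`; (ii) with module 1's (1.100)-datum OF the 𝐑-step, PINNING the residual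
`λ.D1100 P := rPrimeDataOfSel (Tstep rep_k) …` makes `h1102` a theorem of the same proviso (`normalization1102_trhoOfRecord9_rPrimeDataOfSel`).  Hence at the PINNED LAYER
`λ.pinRPrime θ` the displays reduce to: `kSel P < P.K`, positive mass, and EXACTLY Proposition 1 (1.78), (1.80), (1.89).  The record-level closers are given in the
honest SLOTS form (hypotheses over the hidden residual layers, as node00-def's and n12-d's): the pin is an EQUATION on the hidden layer's `D1100` — satisfiable
(`pinRPrime`), not derivable from the record predicate as it stands (its `λ` is free data); making it definitional is NODE 00's act (PIN RECIPE: drop `D1100` from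
`ResidW`, or let `IsRecordOfRecord…W` range over `pinRPrime`d layers).

WHAT THIS FILE PROVES (0 `sorry`; one small def `ResidW.pinRPrime`).
§1 `provisosSupp_repTOfRecord9_of_provisos₁₀` (the record's `rstep` IS the knit datum's support-form provisos), `terms_of_provisos₁₀` (`hm ∕ h0 ∕ hC` read off it),
   `normalization1102_trhoOfRecord9_of_provisos₁₀` ((1.102) for `𝐓ρ_k` of record at the 𝐑-step's (1.100)-reading, from `Provisos₁₀` alone).
§2 `ResidW.pinRPrime` + field lemmas (`rfl`); `wDisplays₁₀_of_rPrimePin` (displays ⇐ `Provisos₁₀` + `kSel P < P.K` + the pin equation + mass + Prop 1 + (1.80) + (1.89)),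
   **`wDisplays₁₀_pinRPrime_of`** (the same at the pinned layer, pin by `rfl`), `b15Leaf_WOfRecord₁₀_pinRPrime_of` ∕ `b15Leaf_WOfRecord₁₁_pinRPrime_of` (the [IV] leaf at the
   bundle of record with pinned (1.100) data).
§3 **`b15_main_of_isRecordOfRecord₁₀CB10YZW_of_rPrimePin`**, **`b15_main_of_isRecordOfRecord₁₁CB10YZW_of_rPrimePin`** (N12 at every run of a ₁₀CB10YZW ∕ ₁₁CB10YZW record,
   slots form: per presenting package and run, `kSel P < P.K`, the pin equation, positive mass, Proposition 1 (1.78), (1.80), (1.89)).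
§4 A2: `exists_residW_pinRPrime` (pinned layers exist for every record parameter), `wDisplays₁₀_pinRPrime_iff` (at a pinned layer with `kSel P < P.K` the display structure
   IS «mass ∧ Prop 1 ∧ (1.80) ∧ (1.89)» — nothing hidden in the pin).

HONEST FRAMING.  Count-neutral kernel bookkeeping by name; one residual-layer transformer (`pinRPrime`, data, no law); NO estimate; nothing of Bałaban's asserted; N12 NOT
discharged — after the pin it is positive mass + EXACTLY Proposition 1 (1.78), (1.80), (1.89) at the objects of record (+ NODE 00's choice of `kSel` with `kSel P < P.K`);
one finite four-torus programme at fixed `ε`, Bałaban AS PRINTED with locators; nothing continuum ∕ ℝ⁴ ∕ OS ∕ mass gap ∕ Clay.  No `sorry`, no `axiom`, no `instance`, no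
`notation`.
-/

noncomputable section

open scoped BigOperators
open MeasureTheory

namespace Literature.MathematicalPhysics.QuantumFieldTheory.Balaban1983to89.B15RPrime1100AtRecord

open DagBinding T4Continuum Node00
open B15 (Prop1Printed Ineq180)
open B15.BasicStep (fibreIntegral Claim189)
open B15Sect1Statements (RPrimeData Normalization1102)
open B15Claim189Assembly (Setting189 new189 chiPP dom)
open B8Eq17ClassAkV1 (plaqsOf)
open B15RPrime1100OfRep (rPrimeDataOfSel normalization1102_trhoOfRecord9_rPrimeDataOfSel)

variable {F : T4Family} {N : ℕ} [NeZero N]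

/-! ## §1. The record's `rstep` proviso IS the support-form provisos of the knit datum at `Tstep rep_k` -/

section RStep

variable (θ : Stage9Params F N)

/-- **def-T's `Provisos₁₀.rstep P k` IS n10-b's support-form provisos of the N12 knit datum at `Tstep rep_k`** — regions := the sequences of record at level `k+1`,
pieces := the pre-𝐑 terms `t_s = χ_{k+1}(s)·(𝐓e^A)_{k+1}(s)`, `Z ↦ Z″ := ppSel P _ (k+1)`, fresh variables `fibOfSeq … (k+1)` — by def-R's `rfl` bridge
`toRepData_towerRepOfRecord_eq` (any bond decidability: `rstep` is instance-generic). [cite: Balaban1989LargeFieldI, (0.3) p.176; Balaban1988Convergent, (3.25) p.270 (bookkeeping)] -/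
theorem provisosSupp_repTOfRecord9_of_provisos₁₀ (hP : θ.Provisos₁₀) (P : B12.RunParams) (k : ℕ) [DecidableEq (PBond (F.P P.K) (k + 1))] (hk : k < P.K) :
    (repDataOfSel (repTOfRecord9 F N θ.ν θ.τ9 (EOfRecord₁₀ F N θ) (wOfRecord₉ F N θ) θ.ppSel P (gOfRecord₁₀ F N θ P) k)
      (θ.ppSel P (gOfRecord₁₀ F N θ P) (k + 1)) (fibOfSeq F θ.ν θ.τ9 P (gOfRecord₁₀ F N θ P) (k + 1))).ProvisosSupp := by
  have h := hP.rstep P k hk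
  rw [toRepData_towerRepOfRecord_eq] at h
  exact h

/-- **The three structural displays `hm ∕ h0 ∕ hC` of `WDisplays₁₀` READ OFF THE RECORD**: the pre-𝐑 terms of `Tstep rep_k`, `k < K`, are measurable, nonnegative and
uniformly bounded by `Provisos₁₀.rstep` (its first three conjuncts). [cite: Balaban1989LargeFieldI, (0.2)–(0.3) p.176, p.176 ll.14–16 (bookkeeping)] -/
theorem terms_of_provisos₁₀ (hP : θ.Provisos₁₀) (P : B12.RunParams) (k : ℕ) (hk : k < P.K) :
    (∀ s, Measurable (rterm (repTOfRecord9 F N θ.ν θ.τ9 (EOfRecord₁₀ F N θ) (wOfRecord₉ F N θ) θ.ppSel P (gOfRecord₁₀ F N θ P) k) s)) ∧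
    (∀ s V, 0 ≤ rterm (repTOfRecord9 F N θ.ν θ.τ9 (EOfRecord₁₀ F N θ) (wOfRecord₉ F N θ) θ.ppSel P (gOfRecord₁₀ F N θ P) k) s V) ∧
    ∃ Cρ : ℝ, ∀ s V, rterm (repTOfRecord9 F N θ.ν θ.τ9 (EOfRecord₁₀ F N θ) (wOfRecord₉ F N θ) θ.ppSel P (gOfRecord₁₀ F N θ P) k) s V ≤ Cρ := by
  classical
  obtain ⟨hm, h0, hC, -⟩ := provisosSupp_repTOfRecord9_of_provisos₁₀ θ hP P k hk
  exact ⟨hm, h0, hC⟩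

/-- **(1.102) FOR `𝐓ρ_k` OF RECORD at the 𝐑-step's (1.100)-reading, FROM `Provisos₁₀` ALONE** (`k < K`): module 1's `normalization1102_trhoOfRecord9_rPrimeDataOfSel` fed by
`rstep`. [cite: Balaban1989LargeFieldI, (1.102) p.201, (0.4) p.176; Balaban1988Convergent, (3.25) p.270] -/
theorem normalization1102_trhoOfRecord9_of_provisos₁₀ (hP : θ.Provisos₁₀) (P : B12.RunParams) (k : ℕ) [DecidableEq (PBond (F.P P.K) (k + 1))] (hk : k < P.K) :
    Normalization1102
      (rPrimeDataOfSel (repTOfRecord9 F N θ.ν θ.τ9 (EOfRecord₁₀ F N θ) (wOfRecord₉ F N θ) θ.ppSel P (gOfRecord₁₀ F N θ P) k)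
        (θ.ppSel P (gOfRecord₁₀ F N θ P) (k + 1)) (fibOfSeq F θ.ν θ.τ9 P (gOfRecord₁₀ F N θ P) (k + 1)))
      (trhoOfRecord9 F N θ.ν θ.τ9 (EOfRecord₁₀ F N θ) (wOfRecord₉ F N θ) θ.ppSel P (gOfRecord₁₀ F N θ P) k) :=
  normalization1102_trhoOfRecord9_rPrimeDataOfSel θ.ν θ.τ9 (EOfRecord₁₀ F N θ) (wOfRecord₉ F N θ) θ.ppSel P (gOfRecord₁₀ F N θ P) k
    (provisosSupp_repTOfRecord9_of_provisos₁₀ θ hP P k hk)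

end RStep

/-! ## §2. The residual [IV] layer with the (1.100) data PINNED to the 𝐑-step's reading, and the displays there -/

section Pin

variable (θ : Stage9Params F N) (lam : ResidW F N)

/-- **THE PINNED RESIDUAL LAYER**: `λ` with its (1.100) data REPLACED, per run, by the (1.100)-reading of the 𝐑-step of the tower of record at the run's step
`λ.kSel P` (module 1's `rPrimeDataOfSel (Tstep rep_k) (ppSel … (k+1)) (fibOfSeq … (k+1))`); `kSel`, the (1.89) carriers ∕ letters and the Proposition-1 carrier
unchanged.  A function of the record's parameters `θ` (the tower) — data, no law. [cite: Balaban1989LargeFieldI, (1.100) p.201, (0.3) p.176; Balaban1988Convergent, (3.25) p.270 (objects of record)] -/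
def _root_.Literature.MathematicalPhysics.QuantumFieldTheory.Balaban1983to89.Node00.ResidW.pinRPrime (lam : ResidW F N) (θ : Stage9Params F N) : ResidW F N :=
  { lam with
    D1100 := fun P => rPrimeDataOfSel (repTOfRecord9 F N θ.ν θ.τ9 (EOfRecord₁₀ F N θ) (wOfRecord₉ F N θ) θ.ppSel P (gOfRecord₁₀ F N θ P) (lam.kSel P))
      (θ.ppSel P (gOfRecord₁₀ F N θ P) (lam.kSel P + 1)) (fibOfSeq F θ.ν θ.τ9 P (gOfRecord₁₀ F N θ P) (lam.kSel P + 1)) }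

/-- The pin keeps the step selector (`rfl`). [cite: Balaban1989LargeFieldI, (0.2) p.176 (bookkeeping)] -/
theorem pinRPrime_kSel : (lam.pinRPrime θ).kSel = lam.kSel := rfl

/-- The pin keeps the Proposition-1 carrier (`rfl`). [cite: Balaban1989LargeFieldI, Prop. 1 p.194 (bookkeeping)] -/
theorem pinRPrime_LF : (lam.pinRPrime θ).LF = lam.LF := rfl

/-- The pin keeps the (1.89) letters (`rfl`). [cite: Balaban1989LargeFieldI, (1.89) p.198 (bookkeeping)] -/
theorem pinRPrime_D189 : (lam.pinRPrime θ).D189 = lam.D189 := rfl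

/-- The pinned (1.100) data at run `P` (`rfl`). [cite: Balaban1989LargeFieldI, (1.100) p.201 (bookkeeping)] -/
theorem pinRPrime_D1100 (P : B12.RunParams) :
    (lam.pinRPrime θ).D1100 P
      = rPrimeDataOfSel (repTOfRecord9 F N θ.ν θ.τ9 (EOfRecord₁₀ F N θ) (wOfRecord₉ F N θ) θ.ppSel P (gOfRecord₁₀ F N θ P) (lam.kSel P))
          (θ.ppSel P (gOfRecord₁₀ F N θ P) (lam.kSel P + 1)) (fibOfSeq F θ.ν θ.τ9 P (gOfRecord₁₀ F N θ P) (lam.kSel P + 1)) := rfl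

/-- Pinning twice is pinning once (`rfl`). [cite: Balaban1989LargeFieldI, (1.100) p.201 (bookkeeping)] -/
theorem pinRPrime_pinRPrime : (lam.pinRPrime θ).pinRPrime θ = lam.pinRPrime θ := rfl

/-- The bundle of record at a pinned layer keeps its Proposition-1 carrier (`rfl`). [cite: Balaban1989LargeFieldI, Prop. 1 p.194 (bookkeeping)] -/
theorem WOfRecord₁₀_pinRPrime_LF (P : B12.RunParams) : (WOfRecord₁₀ F N θ (lam.pinRPrime θ) P).LF = lam.LF P := rfl

variable {θ lam}

/-- **THE DISPLAYS FROM THE RECORD AND THE PIN EQUATION**: if the run's step is below the torus exponent (`λ.kSel P < P.K`) and the layer's (1.100) data at `P` IS the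
𝐑-step's (1.100)-reading, then `WDisplays₁₀ θ λ P` follows from `Provisos₁₀` (⇒ `hm ∕ h0 ∕ hC ∕ h1102`), positive mass of the pre-𝐑 terms, and EXACTLY Proposition 1 (1.78),
(1.80) on the ℍ-domains, (1.89). [cite: Balaban1989LargeFieldI, (0.2)–(0.4) p.176, Prop. 1 (1.78) p.194, (1.80) p.195, (1.89) p.198, (1.99)–(1.102) pp.200–201] -/
theorem wDisplays₁₀_of_rPrimePin (hP : θ.Provisos₁₀) {P : B12.RunParams} (hk : lam.kSel P < P.K)
    (hpin : lam.D1100 P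
      = rPrimeDataOfSel (repTOfRecord9 F N θ.ν θ.τ9 (EOfRecord₁₀ F N θ) (wOfRecord₉ F N θ) θ.ppSel P (gOfRecord₁₀ F N θ P) (lam.kSel P))
          (θ.ppSel P (gOfRecord₁₀ F N θ P) (lam.kSel P + 1)) (fibOfSeq F θ.ν θ.τ9 P (gOfRecord₁₀ F N θ P) (lam.kSel P + 1)))
    (hmass : ∀ s, 0 < ∫ V, rterm (repTOfRecord9 F N θ.ν θ.τ9 (EOfRecord₁₀ F N θ) (wOfRecord₉ F N θ) θ.ppSel P (gOfRecord₁₀ F N θ P) (lam.kSel P)) s V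
      ∂(fieldMeasure (F.P P.K) (lam.kSel P + 1) (SU N)))
    (hP1 : Prop1Printed (lam.LF P))
    (h180 : ∀ U, new189 (lam.D189 P) U → ∀ i, (lam.D189 P).h ≤ i → i ≤ (lam.D189 P).k → ∀ q ∈ plaqsOf (dom (lam.D189 P) i),
      Ineq180 ((lam.D189 P).dev0 U q) ((lam.D189 P).ε (lam.D189 P).k) (lam.D189 P).η (lam.D189 P).B₃ (lam.D189 P).B₅ (lam.D189 P).M (lam.D189 P).δ
        ((lam.D189 P).dist q) (lam.D189 P).O1)
    (h189 : Claim189 (new189 (lam.D189 P)) (chiPP (lam.D189 P))) : WDisplays₁₀ θ lam P := by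
  obtain ⟨hm, h0, hC⟩ := terms_of_provisos₁₀ θ hP P (lam.kSel P) hk
  refine ⟨hm, h0, hC, hmass, hP1, h180, h189, ?_⟩
  rw [hpin]
  exact normalization1102_trhoOfRecord9_of_provisos₁₀ θ hP P (lam.kSel P) hk

/-- **THE DISPLAYS AT THE PINNED LAYER `λ.pinRPrime θ`** (pin equation by `rfl`): `Provisos₁₀` + `λ.kSel P < P.K` + positive mass + EXACTLY Proposition 1 (1.78), (1.80),
(1.89) ⇒ `WDisplays₁₀ θ (λ.pinRPrime θ) P` — `hm ∕ h0 ∕ hC ∕ h1102` DISCHARGED. [cite: Balaban1989LargeFieldI, (0.2)–(0.4) p.176, Prop. 1 (1.78) p.194, (1.80) p.195, (1.89) p.198, (1.99)–(1.102) pp.200–201] -/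
theorem wDisplays₁₀_pinRPrime_of (hP : θ.Provisos₁₀) {P : B12.RunParams} (hk : lam.kSel P < P.K)
    (hmass : ∀ s, 0 < ∫ V, rterm (repTOfRecord9 F N θ.ν θ.τ9 (EOfRecord₁₀ F N θ) (wOfRecord₉ F N θ) θ.ppSel P (gOfRecord₁₀ F N θ P) (lam.kSel P)) s V
      ∂(fieldMeasure (F.P P.K) (lam.kSel P + 1) (SU N)))
    (hP1 : Prop1Printed (lam.LF P))
    (h180 : ∀ U, new189 (lam.D189 P) U → ∀ i, (lam.D189 P).h ≤ i → i ≤ (lam.D189 P).k → ∀ q ∈ plaqsOf (dom (lam.D189 P) i),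
      Ineq180 ((lam.D189 P).dev0 U q) ((lam.D189 P).ε (lam.D189 P).k) (lam.D189 P).η (lam.D189 P).B₃ (lam.D189 P).B₅ (lam.D189 P).M (lam.D189 P).δ
        ((lam.D189 P).dist q) (lam.D189 P).O1)
    (h189 : Claim189 (new189 (lam.D189 P)) (chiPP (lam.D189 P))) : WDisplays₁₀ θ (lam.pinRPrime θ) P :=
  wDisplays₁₀_of_rPrimePin (lam := lam.pinRPrime θ) hP hk rfl hmass hP1 h180 h189

/-- Conversely the display structure at a pinned layer RETURNS the mass and the three printed statements — nothing is hidden in the pin; with `Provisos₁₀` and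
`kSel P < P.K` the display structure at `λ.pinRPrime θ` IS «mass ∧ Prop 1 ∧ (1.80) ∧ (1.89)» (A2). [cite: Balaban1989LargeFieldI, Prop. 1 (1.78) p.194, (1.80) p.195, (1.89) p.198, p.176 ll.14–16 (bookkeeping)] -/
theorem wDisplays₁₀_pinRPrime_iff (hP : θ.Provisos₁₀) {P : B12.RunParams} (hk : lam.kSel P < P.K) :
    WDisplays₁₀ θ (lam.pinRPrime θ) P ↔
      (∀ s, 0 < ∫ V, rterm (repTOfRecord9 F N θ.ν θ.τ9 (EOfRecord₁₀ F N θ) (wOfRecord₉ F N θ) θ.ppSel P (gOfRecord₁₀ F N θ P) (lam.kSel P)) s V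
        ∂(fieldMeasure (F.P P.K) (lam.kSel P + 1) (SU N))) ∧
      Prop1Printed (lam.LF P) ∧
      (∀ U, new189 (lam.D189 P) U → ∀ i, (lam.D189 P).h ≤ i → i ≤ (lam.D189 P).k → ∀ q ∈ plaqsOf (dom (lam.D189 P) i),
        Ineq180 ((lam.D189 P).dev0 U q) ((lam.D189 P).ε (lam.D189 P).k) (lam.D189 P).η (lam.D189 P).B₃ (lam.D189 P).B₅ (lam.D189 P).M (lam.D189 P).δ
          ((lam.D189 P).dist q) (lam.D189 P).O1) ∧
      Claim189 (new189 (lam.D189 P)) (chiPP (lam.D189 P)) :=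
  ⟨fun hd => ⟨hd.hmass, hd.hP1, hd.h180, hd.h189⟩, fun ⟨hmass, hP1, h180, h189⟩ => wDisplays₁₀_pinRPrime_of hP hk hmass hP1 h180 h189⟩

/-- **THE [IV] LEAF AT THE BUNDLE OF RECORD (Stage 10) WITH PINNED (1.100) DATA** from `Provisos₁₀`, `kSel P < P.K`, positive mass and EXACTLY Proposition 1 (1.78),
(1.80), (1.89) (node00-def g30's `b15Leaf_WOfRecord₁₀_of_displays` at the pinned layer). [cite: Balaban1989LargeFieldI, (0.2)–(0.6) p.176, Prop. 1 (1.78) p.194, (1.80) p.195, (1.89) p.198, (1.102) p.201] -/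
theorem b15Leaf_WOfRecord₁₀_pinRPrime_of (hP : θ.Provisos₁₀) {P : B12.RunParams} (hk : lam.kSel P < P.K)
    (hmass : ∀ s, 0 < ∫ V, rterm (repTOfRecord9 F N θ.ν θ.τ9 (EOfRecord₁₀ F N θ) (wOfRecord₉ F N θ) θ.ppSel P (gOfRecord₁₀ F N θ P) (lam.kSel P)) s V
      ∂(fieldMeasure (F.P P.K) (lam.kSel P + 1) (SU N)))
    (hP1 : Prop1Printed (lam.LF P))
    (h180 : ∀ U, new189 (lam.D189 P) U → ∀ i, (lam.D189 P).h ≤ i → i ≤ (lam.D189 P).k → ∀ q ∈ plaqsOf (dom (lam.D189 P) i),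
      Ineq180 ((lam.D189 P).dev0 U q) ((lam.D189 P).ε (lam.D189 P).k) (lam.D189 P).η (lam.D189 P).B₃ (lam.D189 P).B₅ (lam.D189 P).M (lam.D189 P).δ
        ((lam.D189 P).dist q) (lam.D189 P).O1)
    (h189 : Claim189 (new189 (lam.D189 P)) (chiPP (lam.D189 P))) : B15Leaf (WOfRecord₁₀ F N θ (lam.pinRPrime θ) P) :=
  b15Leaf_WOfRecord₁₀_of_displays (wDisplays₁₀_pinRPrime_of hP hk hmass hP1 h180 h189)

/-- **The same at Stage 11** (`WOfRecord₁₁ θ := WOfRecord₁₀ θ.toStage9Params`, `Provisos₁₁.base`). [cite: Balaban1989LargeFieldI, (0.2)–(0.6) p.176, Prop. 1 (1.78) p.194, (1.80) p.195, (1.89) p.198, (1.102) p.201] -/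
theorem b15Leaf_WOfRecord₁₁_pinRPrime_of {θ : Stage11Params F N} (hP : θ.Provisos₁₁) {lam : ResidW F N} {P : B12.RunParams} (hk : lam.kSel P < P.K)
    (hmass : ∀ s, 0 < ∫ V, rterm (repTOfRecord9 F N θ.ν θ.τ9 (EOfRecord₁₀ F N θ.toStage9Params) (wOfRecord₉ F N θ.toStage9Params) θ.ppSel P
      (gOfRecord₁₀ F N θ.toStage9Params P) (lam.kSel P)) s V ∂(fieldMeasure (F.P P.K) (lam.kSel P + 1) (SU N)))
    (hP1 : Prop1Printed (lam.LF P))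
    (h180 : ∀ U, new189 (lam.D189 P) U → ∀ i, (lam.D189 P).h ≤ i → i ≤ (lam.D189 P).k → ∀ q ∈ plaqsOf (dom (lam.D189 P) i),
      Ineq180 ((lam.D189 P).dev0 U q) ((lam.D189 P).ε (lam.D189 P).k) (lam.D189 P).η (lam.D189 P).B₃ (lam.D189 P).B₅ (lam.D189 P).M (lam.D189 P).δ
        ((lam.D189 P).dist q) (lam.D189 P).O1)
    (h189 : Claim189 (new189 (lam.D189 P)) (chiPP (lam.D189 P))) :
    B15Leaf (WOfRecord₁₁ F N θ (lam.pinRPrime θ.toStage9Params) P) :=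
  b15Leaf_WOfRecord₁₀_pinRPrime_of hP.base hk hmass hP1 h180 h189

variable (F N) in
/-- **A2 — pinned layers EXIST for every parameter and every residual layer** (the pin is a transformer of data; combined with node00-def g30's `nonempty_residW` the
pinned class is inhabited). [cite: Balaban1989LargeFieldI, (1.100) p.201 (bookkeeping witness)] -/
theorem exists_residW_pinRPrime (θ : Stage9Params F N) : ∃ lam : ResidW F N, lam.pinRPrime θ = lam :=
  let ⟨lam₀⟩ := nonempty_residW F N
  ⟨lam₀.pinRPrime θ, pinRPrime_pinRPrime θ lam₀⟩

end Pin

/-! ## §3. N12 at the records ₁₀CB10YZW ∕ ₁₁CB10YZW with the (1.100) data pinned — slots form over the hidden layers -/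

section Record

variable {D : FiniteEpsData F (SU N)} {w : WorldP}

/-- **N12 AT A RECORD OF `IsRecordOfRecord₁₀CB10YZW`, (1.100) DATA PINNED, SLOTS FORM**: if every parameter package presenting `(D, w)` reads, at every run, a step below
the torus exponent, a residual (1.100)-datum EQUAL to the 𝐑-step's (1.100)-reading, pre-𝐑 terms of positive mass, and EXACTLY Proposition 1 (1.78), (1.80) on the
ℍ-domains, (1.89), then `Dag.B15_main (leavesP w P)` at every run (node00-def g30's `b15_main_of_isRecordOfRecord₁₀CB10YZW_of_displays` ∘ `wDisplays₁₀_of_rPrimePin`).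
Honest: hypotheses over the HIDDEN layers; the pin equation is NOT derivable from the predicate (its `λ` is free) — NODE 00's act to make it definitional.
[cite: Balaban1989LargeFieldI, Prop. 1 (1.78) p.194, (0.2)–(0.6) p.176, (1.80) p.195, (1.89) p.198, (1.99)–(1.102) pp.200–201; Balaban1989LargeFieldII, Thm 1 + (0.1) pp.355–356 (the record)] -/
theorem b15_main_of_isRecordOfRecord₁₀CB10YZW_of_rPrimePin (h : IsRecordOfRecord₁₀CB10YZW F N D w)
    (hyp : ∀ (θ : Stage9Params F N) (hP : θ.Provisos₁₀) (Mstar : ℕ) (ops : OpsY N θ.toStage3Params Mstar) (ζ : ResidZ F N) (lam : ResidW F N), θ.Admissible →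
      D = datumOfRecord₁₀ F N θ hP → (∀ P, w.up P = upOfRecord₅C F N (θ.view₁₀B10YZW F N Mstar ops ζ lam) P) → ∀ P : B12.RunParams,
        lam.kSel P < P.K ∧
        lam.D1100 P
          = rPrimeDataOfSel (repTOfRecord9 F N θ.ν θ.τ9 (EOfRecord₁₀ F N θ) (wOfRecord₉ F N θ) θ.ppSel P (gOfRecord₁₀ F N θ P) (lam.kSel P))
              (θ.ppSel P (gOfRecord₁₀ F N θ P) (lam.kSel P + 1)) (fibOfSeq F θ.ν θ.τ9 P (gOfRecord₁₀ F N θ P) (lam.kSel P + 1)) ∧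
        (∀ s, 0 < ∫ V, rterm (repTOfRecord9 F N θ.ν θ.τ9 (EOfRecord₁₀ F N θ) (wOfRecord₉ F N θ) θ.ppSel P (gOfRecord₁₀ F N θ P) (lam.kSel P)) s V
          ∂(fieldMeasure (F.P P.K) (lam.kSel P + 1) (SU N))) ∧
        Prop1Printed (lam.LF P) ∧
        (∀ U, new189 (lam.D189 P) U → ∀ i, (lam.D189 P).h ≤ i → i ≤ (lam.D189 P).k → ∀ q ∈ plaqsOf (dom (lam.D189 P) i),
          Ineq180 ((lam.D189 P).dev0 U q) ((lam.D189 P).ε (lam.D189 P).k) (lam.D189 P).η (lam.D189 P).B₃ (lam.D189 P).B₅ (lam.D189 P).M (lam.D189 P).δ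
            ((lam.D189 P).dist q) (lam.D189 P).O1) ∧
        Claim189 (new189 (lam.D189 P)) (chiPP (lam.D189 P)))
    (P : B12.RunParams) : Dag.B15_main (leavesP w P) :=
  b15_main_of_isRecordOfRecord₁₀CB10YZW_of_displays h (fun θ hP Mstar ops ζ lam hθ hD hup Q => by
    obtain ⟨hk, hpin, hmass, hP1, h180, h189⟩ := hyp θ hP Mstar ops ζ lam hθ hD hup Q
    exact wDisplays₁₀_of_rPrimePin hP hk hpin hmass hP1 h180 h189) P

/-- **N12 AT A RECORD OF `IsRecordOfRecord₁₁CB10YZW`, (1.100) DATA PINNED, SLOTS FORM** — the Stage-11 twin (node00-def g31's `Record11Carriers`: the `rBasicStep` leaf at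
the four-pin view IS `B15Leaf (WOfRecord₁₁ θ λ P)`, `upOfRecord₅C_view₁₁B10YZW_leaves`). [cite: Balaban1989LargeFieldI, Prop. 1 (1.78) p.194, (0.2)–(0.6) p.176, (1.80) p.195, (1.89) p.198, (1.99)–(1.102) pp.200–201; Balaban1989LargeFieldII, Thm 1 + (0.1) pp.355–356 (the record)] -/
theorem b15_main_of_isRecordOfRecord₁₁CB10YZW_of_rPrimePin (h : IsRecordOfRecord₁₁CB10YZW F N D w)
    (hyp : ∀ (θ : Stage11Params F N) (hP : θ.Provisos₁₁) (Mstar : ℕ) (ops : OpsY N θ.toStage3Params Mstar) (ζ : ResidZ F N) (lam : ResidW F N), θ.Admissible →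
      D = datumOfRecord₁₁ F N θ hP → (∀ P, w.up P = upOfRecord₅C F N (θ.view₁₁B10YZW F N Mstar ops ζ lam) P) → ∀ P : B12.RunParams,
        lam.kSel P < P.K ∧
        lam.D1100 P
          = rPrimeDataOfSel (repTOfRecord9 F N θ.ν θ.τ9 (EOfRecord₁₀ F N θ.toStage9Params) (wOfRecord₉ F N θ.toStage9Params) θ.ppSel P
                (gOfRecord₁₀ F N θ.toStage9Params P) (lam.kSel P))
              (θ.ppSel P (gOfRecord₁₀ F N θ.toStage9Params P) (lam.kSel P + 1)) (fibOfSeq F θ.ν θ.τ9 P (gOfRecord₁₀ F N θ.toStage9Params P) (lam.kSel P + 1)) ∧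
        (∀ s, 0 < ∫ V, rterm (repTOfRecord9 F N θ.ν θ.τ9 (EOfRecord₁₀ F N θ.toStage9Params) (wOfRecord₉ F N θ.toStage9Params) θ.ppSel P
          (gOfRecord₁₀ F N θ.toStage9Params P) (lam.kSel P)) s V ∂(fieldMeasure (F.P P.K) (lam.kSel P + 1) (SU N))) ∧
        Prop1Printed (lam.LF P) ∧
        (∀ U, new189 (lam.D189 P) U → ∀ i, (lam.D189 P).h ≤ i → i ≤ (lam.D189 P).k → ∀ q ∈ plaqsOf (dom (lam.D189 P) i),
          Ineq180 ((lam.D189 P).dev0 U q) ((lam.D189 P).ε (lam.D189 P).k) (lam.D189 P).η (lam.D189 P).B₃ (lam.D189 P).B₅ (lam.D189 P).M (lam.D189 P).δ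
            ((lam.D189 P).dist q) (lam.D189 P).O1) ∧
        Claim189 (new189 (lam.D189 P)) (chiPP (lam.D189 P)))
    (P : B12.RunParams) : Dag.B15_main (leavesP w P) := by
  obtain ⟨θ, hP, Mstar, ops, ζ, lam, hθ, hD, -, -, -, hup⟩ := h
  obtain ⟨hk, hpin, hmass, hP1, h180, h189⟩ := hyp θ hP Mstar ops ζ lam hθ hD hup P
  have hd : WDisplays₁₀ θ.toStage9Params lam P := wDisplays₁₀_of_rPrimePin hP.base hk hpin hmass hP1 h180 h189
  intro _ _ _ _ _
  show (w.up P).rBasicStep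
  rw [hup P]
  exact (upOfRecord₅C_view₁₁B10YZW_leaves F N θ Mstar ops ζ lam P).1.2 (b15Leaf_WOfRecord₁₀_of_displays hd)

end Record

/-! ## §4. (v1.1) The (1.80) → (1.89) junction at the pinned layer: (1.89) BY p29's PRINTED LEAVES with `L80 :=` the (1.80) display -/

section Leaves189

open B15.PrelimIntegrations (Ineq191 Ineq195)
open B15Chi124DetSets (E124)
open B15Claim189Assembly (X domK half claim189_assembly_of_flow)
open GaugeGroup (dist1)
open GaugeField (plaqHol)

variable {θ : Stage9Params F N} {lam : ResidW F N}

/-- **THE DISPLAYS AT A LAYER WITH PINNED (1.100) DATA, WITH (1.89) TRACED TO ITS PRINTED LEAVES AND (1.80) CONSUMED** (v1.1): as `wDisplays₁₀_of_rPrimePin`, but the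
(1.89) display `Claim189 (new189 D) (chiPP D)`, `D := λ.D189 P`, is DERIVED by p29's one-theorem assembly `claim189_assembly_of_flow` (p387003 + `_of_flow`) from its
located inputs — the printed leaves (1.90)–(1.91) `L91h`, (1.93)–(1.95) `L95` on the half domain, p. 199's (1.91)-type bounds `L91` ∕ `L97` on the ℍ-domains, the
[III] (2.8) flow relation `hflow`, p. 200's shell geometry `hgeom` ∕ choice of `M` `hlarge` ∕ *"j = k"* `hjEqK` ∕ `X′`, the (1.88) cube cover `hbox`, print's numerics —
with its `L80` input FED BY THE (1.80) DISPLAY `h180` (p. 199: *"The plaquette variables of U₀^{ū₀} satisfy the estimate (1.80)"*).  So at such a layer N12's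
displayed [IV] ESTIMATES are Proposition 1 (1.78), (1.80), and (1.89)'s printed leaves; (0.4), (0.6), (1.102) and the (1.89) assembly are theorems.
[cite: Balaban1989LargeFieldI, (1.89) p.198, pp.199–200, (1.80) p.195, Prop. 1 (1.78) p.194, (0.2)–(0.4) p.176, (1.99)–(1.102) pp.200–201] -/
theorem wDisplays₁₀_of_rPrimePin_leaves189 (hP : θ.Provisos₁₀) {P : B12.RunParams} (hk : lam.kSel P < P.K)
    (hpin : lam.D1100 P
      = rPrimeDataOfSel (repTOfRecord9 F N θ.ν θ.τ9 (EOfRecord₁₀ F N θ) (wOfRecord₉ F N θ) θ.ppSel P (gOfRecord₁₀ F N θ P) (lam.kSel P))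
          (θ.ppSel P (gOfRecord₁₀ F N θ P) (lam.kSel P + 1)) (fibOfSeq F θ.ν θ.τ9 P (gOfRecord₁₀ F N θ P) (lam.kSel P + 1)))
    (hmass : ∀ s, 0 < ∫ V, rterm (repTOfRecord9 F N θ.ν θ.τ9 (EOfRecord₁₀ F N θ) (wOfRecord₉ F N θ) θ.ppSel P (gOfRecord₁₀ F N θ P) (lam.kSel P)) s V
      ∂(fieldMeasure (F.P P.K) (lam.kSel P + 1) (SU N)))
    (hP1 : Prop1Printed (lam.LF P))
    (h180 : ∀ U, new189 (lam.D189 P) U → ∀ i, (lam.D189 P).h ≤ i → i ≤ (lam.D189 P).k → ∀ q ∈ plaqsOf (dom (lam.D189 P) i),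
      Ineq180 ((lam.D189 P).dev0 U q) ((lam.D189 P).ε (lam.D189 P).k) (lam.D189 P).η (lam.D189 P).B₃ (lam.D189 P).B₅ (lam.D189 P).M (lam.D189 P).δ
        ((lam.D189 P).dist q) (lam.D189 P).O1)
    -- the located inputs of p29's `claim189_assembly_of_flow` at `D := λ.D189 P`, EXCEPT `L80` (fed by `h180`)
    (hhk : (lam.D189 P).h ≤ (lam.D189 P).k₀) (hk₀ : (lam.D189 P).k₀ + 2 ≤ (lam.D189 P).k)
    (hΩ : ∀ i, (lam.D189 P).Ω (i + 1) ⊆ (lam.D189 P).Ω i) (hΩtop : (lam.D189 P).Ω (lam.D189 P).k ⊆ (lam.D189 P).Ω ((lam.D189 P).k + 1))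
    (hα : (lam.D189 P).α = 1 / 12) (hβ0 : 0 ≤ (lam.D189 P).β) (hβ : (lam.D189 P).β ≤ 1 / 4) (hL₀ : 2 ≤ (lam.D189 P).L₀)
    (hL₀L : (lam.D189 P).L₀ ^ 2 ≤ (lam.D189 P).L) (hε0 : ∀ i, 0 ≤ (lam.D189 P).ε i) (hε1 : ∀ i, (lam.D189 P).ε i ≤ 1 / 10)
    (hB : 0 ≤ (lam.D189 P).O1 * (lam.D189 P).B₃ * (lam.D189 P).B₅ * (lam.D189 P).M ^ 5) (hδ : 0 ≤ (lam.D189 P).δ) (hM : 0 ≤ (lam.D189 P).M)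
    (hdist : ∀ p, 0 ≤ (lam.D189 P).dist p)
    {X' : ℝ} (hX' : ∀ j, 2 + X (lam.D189 P) j ≤ X') (hsmall : X' * (((lam.D189 P).L₀ ^ 2) ^ ((lam.D189 P).k - (lam.D189 P).k₀ - 1))⁻¹ ≤ 1 / 4)
    (hjEqK : ∀ m, (lam.D189 P).k₀ < m → m < (lam.D189 P).k → (lam.D189 P).Ω m \ (lam.D189 P).Ω (m + 1) ⊆ domK (lam.D189 P))
    (hgeom : ∀ m, (lam.D189 P).k₀ < m → m < (lam.D189 P).k → ∀ p ∈ plaqsOf ((lam.D189 P).Ω m \ (lam.D189 P).Ω (m + 1)),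
      4 * ((m : ℝ) - (lam.D189 P).k₀) * (lam.D189 P).M ≤ (lam.D189 P).dist p)
    (hlarge : X (lam.D189 P) (lam.D189 P).k * Real.exp (-(4 * (lam.D189 P).δ * (lam.D189 P).M)) ≤ (lam.D189 P).α)
    {β₀ : ℝ} (hβ₀0 : 0 ≤ β₀) (hβ₀ : β₀ ≤ 1 / 2)
    (hflow : ∀ j, (lam.D189 P).h ≤ j → j < (lam.D189 P).k →
      (lam.D189 P).ε (lam.D189 P).k ≤ (1 + β₀) * Real.sqrt (((lam.D189 P).k - j : ℕ) : ℝ) * (lam.D189 P).ε j)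
    (hbox : ∀ p ∈ plaqsOf (half (lam.D189 P)), (lam.D189 P).boxOf p ∈ (lam.D189 P).halfcubes ∧ p ∈ (lam.D189 P).plaqT ((lam.D189 P).boxOf p))
    (L91h : ∀ U, new189 (lam.D189 P) U → ∀ p ∈ plaqsOf (half (lam.D189 P)),
      Ineq191 (dist1 (plaqHol ((lam.D189 P).Upp U) p)) ((lam.D189 P).devV'' U p) (lam.D189 P).α (((lam.D189 P).L ^ (lam.D189 P).h)⁻¹)
        ((lam.D189 P).ε (lam.D189 P).h) (E124 (lam.D189 P).ε (lam.D189 P).L (lam.D189 P).η (lam.D189 P).k (lam.D189 P).h))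
    (L95 : ∀ U, new189 (lam.D189 P) U → ∀ p ∈ plaqsOf (half (lam.D189 P)),
      Ineq195 ((lam.D189 P).devV'' U p) (dist1 (plaqHol ((lam.D189 P).Uhalf U ((lam.D189 P).boxOf p)) p)) (lam.D189 P).α
        (((lam.D189 P).L ^ (lam.D189 P).h)⁻¹) ((lam.D189 P).ε (lam.D189 P).h) (E124 (lam.D189 P).ε (lam.D189 P).L (lam.D189 P).η (lam.D189 P).k (lam.D189 P).h))
    (L91 : ∀ U, new189 (lam.D189 P) U → ∀ j, (lam.D189 P).h ≤ j → j ≤ (lam.D189 P).k → ∀ p ∈ plaqsOf (dom (lam.D189 P) j),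
      Ineq191 (dist1 (plaqHol ((lam.D189 P).Upp U) p)) ((lam.D189 P).dev97 U p) (lam.D189 P).α (((lam.D189 P).L ^ j)⁻¹) ((lam.D189 P).ε j)
        (E124 (lam.D189 P).ε (lam.D189 P).L (lam.D189 P).η (lam.D189 P).k j))
    (L97 : ∀ U, new189 (lam.D189 P) U → ∀ j, (lam.D189 P).h ≤ j → j ≤ (lam.D189 P).k → ∀ p ∈ plaqsOf (dom (lam.D189 P) j),
      Ineq191 ((lam.D189 P).dev97 U p) ((lam.D189 P).dev0 U p) (lam.D189 P).α (((lam.D189 P).L ^ j)⁻¹) ((lam.D189 P).ε j)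
        (E124 (lam.D189 P).ε (lam.D189 P).L (lam.D189 P).η (lam.D189 P).k j)) :
    WDisplays₁₀ θ lam P :=
  wDisplays₁₀_of_rPrimePin hP hk hpin hmass hP1 h180
    (claim189_assembly_of_flow (lam.D189 P) hhk hk₀ hΩ hΩtop hα hβ0 hβ hL₀ hL₀L hε0 hε1 hB hδ hM hdist hX' hsmall hjEqK hgeom hlarge hβ₀0 hβ₀ hflow
      hbox L91h L95 L91 L97 h180)

end Leaves189

/-! ## §5. (v1.2) DEGENERATE RUNS (`P.K ≤ kSel P`, e.g. the `K = 0` tori): the `kSel P < P.K` clause REPAIRED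

A2 SELF-REPORT (this seat): `B12.RunParams.K : ℕ` carries no law `1 ≤ K`, so the per-run clause `λ.kSel P < P.K` of §2–§3 (and of the Summits closers built on
them) is FALSE on every run with `P.K = 0`; as a hypothesis quantified over ALL runs it is unsatisfiable and the slots-form closers of §3 are VACUOUS over any
record predicate as typed (the N12 s2 seat's `exists_world₁₁CB10YZW_b15_main_of_mass` met the same point with its `hdeg` clause).  REPAIR, append-only: the
support-form provisos of the knit datum at the run's step are what §2 actually consumes — below `K` they are the record's own `rstep` (§1), on degenerate runs
they are DISPLAYED (`hdeg`); the (1.100) pin still retires `h1102` on every run (module 1's `normalization1102_trhoOfRecord9_rPrimeDataOfSel` needs the support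
provisos only). -/

section Degenerate

variable {θ : Stage9Params F N} {lam : ResidW F N}

/-- **THE DISPLAYS FROM THE SUPPORT PROVISOS AND THE PIN EQUATION, ANY RUN** (v1.2): n10-b's support-form provisos of the knit datum at the run's step (however
obtained), the (1.100) pin equation, positive mass, Proposition 1 (1.78), (1.80), (1.89) ⇒ `WDisplays₁₀ θ λ P` — `hm ∕ h0 ∕ hC ∕ h1102` from the provisos through
module 1. [cite: Balaban1989LargeFieldI, (0.2)–(0.4) p.176, Prop. 1 (1.78) p.194, (1.80) p.195, (1.89) p.198, (1.99)–(1.102) pp.200–201] -/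
theorem wDisplays₁₀_of_rPrimePin_supp {P : B12.RunParams}
    (hsupp : (repDataOfSel (repTOfRecord9 F N θ.ν θ.τ9 (EOfRecord₁₀ F N θ) (wOfRecord₉ F N θ) θ.ppSel P (gOfRecord₁₀ F N θ P) (lam.kSel P))
      (θ.ppSel P (gOfRecord₁₀ F N θ P) (lam.kSel P + 1)) (fibOfSeq F θ.ν θ.τ9 P (gOfRecord₁₀ F N θ P) (lam.kSel P + 1))).ProvisosSupp)
    (hpin : lam.D1100 P
      = rPrimeDataOfSel (repTOfRecord9 F N θ.ν θ.τ9 (EOfRecord₁₀ F N θ) (wOfRecord₉ F N θ) θ.ppSel P (gOfRecord₁₀ F N θ P) (lam.kSel P))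
          (θ.ppSel P (gOfRecord₁₀ F N θ P) (lam.kSel P + 1)) (fibOfSeq F θ.ν θ.τ9 P (gOfRecord₁₀ F N θ P) (lam.kSel P + 1)))
    (hmass : ∀ s, 0 < ∫ V, rterm (repTOfRecord9 F N θ.ν θ.τ9 (EOfRecord₁₀ F N θ) (wOfRecord₉ F N θ) θ.ppSel P (gOfRecord₁₀ F N θ P) (lam.kSel P)) s V
      ∂(fieldMeasure (F.P P.K) (lam.kSel P + 1) (SU N)))
    (hP1 : Prop1Printed (lam.LF P))
    (h180 : ∀ U, new189 (lam.D189 P) U → ∀ i, (lam.D189 P).h ≤ i → i ≤ (lam.D189 P).k → ∀ q ∈ plaqsOf (dom (lam.D189 P) i),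
      Ineq180 ((lam.D189 P).dev0 U q) ((lam.D189 P).ε (lam.D189 P).k) (lam.D189 P).η (lam.D189 P).B₃ (lam.D189 P).B₅ (lam.D189 P).M (lam.D189 P).δ
        ((lam.D189 P).dist q) (lam.D189 P).O1)
    (h189 : Claim189 (new189 (lam.D189 P)) (chiPP (lam.D189 P))) : WDisplays₁₀ θ lam P := by
  classical
  obtain ⟨hm, h0, hC, -⟩ := id hsupp
  refine ⟨hm, h0, hC, hmass, hP1, h180, h189, ?_⟩
  rw [hpin]
  exact normalization1102_trhoOfRecord9_rPrimeDataOfSel θ.ν θ.τ9 (EOfRecord₁₀ F N θ) (wOfRecord₉ F N θ) θ.ppSel P (gOfRecord₁₀ F N θ P) (lam.kSel P) hsupp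

/-- **THE DISPLAYS WITH THE DEGENERATE-RUN CLAUSE** (v1.2, the repaired form of `wDisplays₁₀_of_rPrimePin`): `Provisos₁₀` + «on a run with `P.K ≤ λ.kSel P` the support
provisos of the knit datum are displayed» (`hdeg`) + the pin equation + mass + Prop. 1 + (1.80) + (1.89) ⇒ `WDisplays₁₀ θ λ P` on EVERY run: below `K` by the record's
`rstep`, otherwise by `hdeg`. [cite: Balaban1989LargeFieldI, (0.2)–(0.4) p.176, Prop. 1 (1.78) p.194, (1.80) p.195, (1.89) p.198, (1.99)–(1.102) pp.200–201] -/
theorem wDisplays₁₀_of_rPrimePin_deg (hP : θ.Provisos₁₀) {P : B12.RunParams}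
    (hdeg : P.K ≤ lam.kSel P →
      (repDataOfSel (repTOfRecord9 F N θ.ν θ.τ9 (EOfRecord₁₀ F N θ) (wOfRecord₉ F N θ) θ.ppSel P (gOfRecord₁₀ F N θ P) (lam.kSel P))
        (θ.ppSel P (gOfRecord₁₀ F N θ P) (lam.kSel P + 1)) (fibOfSeq F θ.ν θ.τ9 P (gOfRecord₁₀ F N θ P) (lam.kSel P + 1))).ProvisosSupp)
    (hpin : lam.D1100 P
      = rPrimeDataOfSel (repTOfRecord9 F N θ.ν θ.τ9 (EOfRecord₁₀ F N θ) (wOfRecord₉ F N θ) θ.ppSel P (gOfRecord₁₀ F N θ P) (lam.kSel P))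
          (θ.ppSel P (gOfRecord₁₀ F N θ P) (lam.kSel P + 1)) (fibOfSeq F θ.ν θ.τ9 P (gOfRecord₁₀ F N θ P) (lam.kSel P + 1)))
    (hmass : ∀ s, 0 < ∫ V, rterm (repTOfRecord9 F N θ.ν θ.τ9 (EOfRecord₁₀ F N θ) (wOfRecord₉ F N θ) θ.ppSel P (gOfRecord₁₀ F N θ P) (lam.kSel P)) s V
      ∂(fieldMeasure (F.P P.K) (lam.kSel P + 1) (SU N)))
    (hP1 : Prop1Printed (lam.LF P))
    (h180 : ∀ U, new189 (lam.D189 P) U → ∀ i, (lam.D189 P).h ≤ i → i ≤ (lam.D189 P).k → ∀ q ∈ plaqsOf (dom (lam.D189 P) i),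
      Ineq180 ((lam.D189 P).dev0 U q) ((lam.D189 P).ε (lam.D189 P).k) (lam.D189 P).η (lam.D189 P).B₃ (lam.D189 P).B₅ (lam.D189 P).M (lam.D189 P).δ
        ((lam.D189 P).dist q) (lam.D189 P).O1)
    (h189 : Claim189 (new189 (lam.D189 P)) (chiPP (lam.D189 P))) : WDisplays₁₀ θ lam P := by
  by_cases hk : lam.kSel P < P.K
  · exact wDisplays₁₀_of_rPrimePin hP hk hpin hmass hP1 h180 h189
  · exact wDisplays₁₀_of_rPrimePin_supp (hdeg (not_lt.mp hk)) hpin hmass hP1 h180 h189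

/-- The same AT THE PINNED LAYER `λ.pinRPrime θ` (pin equation by `rfl`). [cite: Balaban1989LargeFieldI, (0.2)–(0.4) p.176, Prop. 1 (1.78) p.194, (1.80) p.195, (1.89) p.198, (1.99)–(1.102) pp.200–201] -/
theorem wDisplays₁₀_pinRPrime_of_deg (hP : θ.Provisos₁₀) {P : B12.RunParams}
    (hdeg : P.K ≤ lam.kSel P →
      (repDataOfSel (repTOfRecord9 F N θ.ν θ.τ9 (EOfRecord₁₀ F N θ) (wOfRecord₉ F N θ) θ.ppSel P (gOfRecord₁₀ F N θ P) (lam.kSel P))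
        (θ.ppSel P (gOfRecord₁₀ F N θ P) (lam.kSel P + 1)) (fibOfSeq F θ.ν θ.τ9 P (gOfRecord₁₀ F N θ P) (lam.kSel P + 1))).ProvisosSupp)
    (hmass : ∀ s, 0 < ∫ V, rterm (repTOfRecord9 F N θ.ν θ.τ9 (EOfRecord₁₀ F N θ) (wOfRecord₉ F N θ) θ.ppSel P (gOfRecord₁₀ F N θ P) (lam.kSel P)) s V
      ∂(fieldMeasure (F.P P.K) (lam.kSel P + 1) (SU N)))
    (hP1 : Prop1Printed (lam.LF P))
    (h180 : ∀ U, new189 (lam.D189 P) U → ∀ i, (lam.D189 P).h ≤ i → i ≤ (lam.D189 P).k → ∀ q ∈ plaqsOf (dom (lam.D189 P) i),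
      Ineq180 ((lam.D189 P).dev0 U q) ((lam.D189 P).ε (lam.D189 P).k) (lam.D189 P).η (lam.D189 P).B₃ (lam.D189 P).B₅ (lam.D189 P).M (lam.D189 P).δ
        ((lam.D189 P).dist q) (lam.D189 P).O1)
    (h189 : Claim189 (new189 (lam.D189 P)) (chiPP (lam.D189 P))) : WDisplays₁₀ θ (lam.pinRPrime θ) P :=
  wDisplays₁₀_of_rPrimePin_deg (lam := lam.pinRPrime θ) hP hdeg rfl hmass hP1 h180 h189

variable {D : FiniteEpsData F (SU N)} {w : WorldP}

/-- **N12 AT A RECORD OF `IsRecordOfRecord₁₀CB10YZW`, (1.100) DATA PINNED, DEGENERATE-RUN FORM** (v1.2, the repaired slots form of §3): per presenting package and run, the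
degenerate-run clause `P.K ≤ kSel P → ProvisosSupp`, the pin equation, positive mass, Proposition 1 (1.78), (1.80), (1.89) ⇒ `Dag.B15_main (leavesP w P)` at every run —
satisfiable hypotheses on `B12.RunParams` as typed (no `K ≥ 1` law). [cite: Balaban1989LargeFieldI, Prop. 1 (1.78) p.194, (0.2)–(0.6) p.176, (1.80) p.195, (1.89) p.198, (1.99)–(1.102) pp.200–201; Balaban1989LargeFieldII, Thm 1 + (0.1) pp.355–356 (the record)] -/
theorem b15_main_of_isRecordOfRecord₁₀CB10YZW_of_rPrimePin_deg (h : IsRecordOfRecord₁₀CB10YZW F N D w)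
    (hyp : ∀ (θ : Stage9Params F N) (hP : θ.Provisos₁₀) (Mstar : ℕ) (ops : OpsY N θ.toStage3Params Mstar) (ζ : ResidZ F N) (lam : ResidW F N), θ.Admissible →
      D = datumOfRecord₁₀ F N θ hP → (∀ P, w.up P = upOfRecord₅C F N (θ.view₁₀B10YZW F N Mstar ops ζ lam) P) → ∀ P : B12.RunParams,
        (P.K ≤ lam.kSel P →
          (repDataOfSel (repTOfRecord9 F N θ.ν θ.τ9 (EOfRecord₁₀ F N θ) (wOfRecord₉ F N θ) θ.ppSel P (gOfRecord₁₀ F N θ P) (lam.kSel P))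
            (θ.ppSel P (gOfRecord₁₀ F N θ P) (lam.kSel P + 1)) (fibOfSeq F θ.ν θ.τ9 P (gOfRecord₁₀ F N θ P) (lam.kSel P + 1))).ProvisosSupp) ∧
        lam.D1100 P
          = rPrimeDataOfSel (repTOfRecord9 F N θ.ν θ.τ9 (EOfRecord₁₀ F N θ) (wOfRecord₉ F N θ) θ.ppSel P (gOfRecord₁₀ F N θ P) (lam.kSel P))
              (θ.ppSel P (gOfRecord₁₀ F N θ P) (lam.kSel P + 1)) (fibOfSeq F θ.ν θ.τ9 P (gOfRecord₁₀ F N θ P) (lam.kSel P + 1)) ∧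
        (∀ s, 0 < ∫ V, rterm (repTOfRecord9 F N θ.ν θ.τ9 (EOfRecord₁₀ F N θ) (wOfRecord₉ F N θ) θ.ppSel P (gOfRecord₁₀ F N θ P) (lam.kSel P)) s V
          ∂(fieldMeasure (F.P P.K) (lam.kSel P + 1) (SU N))) ∧
        Prop1Printed (lam.LF P) ∧
        (∀ U, new189 (lam.D189 P) U → ∀ i, (lam.D189 P).h ≤ i → i ≤ (lam.D189 P).k → ∀ q ∈ plaqsOf (dom (lam.D189 P) i),
          Ineq180 ((lam.D189 P).dev0 U q) ((lam.D189 P).ε (lam.D189 P).k) (lam.D189 P).η (lam.D189 P).B₃ (lam.D189 P).B₅ (lam.D189 P).M (lam.D189 P).δ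
            ((lam.D189 P).dist q) (lam.D189 P).O1) ∧
        Claim189 (new189 (lam.D189 P)) (chiPP (lam.D189 P)))
    (P : B12.RunParams) : Dag.B15_main (leavesP w P) :=
  b15_main_of_isRecordOfRecord₁₀CB10YZW_of_displays h (fun θ hP Mstar ops ζ lam hθ hD hup Q => by
    obtain ⟨hdeg, hpin, hmass, hP1, h180, h189⟩ := hyp θ hP Mstar ops ζ lam hθ hD hup Q
    exact wDisplays₁₀_of_rPrimePin_deg hP hdeg hpin hmass hP1 h180 h189) P

/-- **The Stage-11 twin, DEGENERATE-RUN FORM** (v1.2). [cite: Balaban1989LargeFieldI, Prop. 1 (1.78) p.194, (0.2)–(0.6) p.176, (1.80) p.195, (1.89) p.198, (1.99)–(1.102) pp.200–201; Balaban1989LargeFieldII, Thm 1 + (0.1) pp.355–356 (the record)] -/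
theorem b15_main_of_isRecordOfRecord₁₁CB10YZW_of_rPrimePin_deg (h : IsRecordOfRecord₁₁CB10YZW F N D w)
    (hyp : ∀ (θ : Stage11Params F N) (hP : θ.Provisos₁₁) (Mstar : ℕ) (ops : OpsY N θ.toStage3Params Mstar) (ζ : ResidZ F N) (lam : ResidW F N), θ.Admissible →
      D = datumOfRecord₁₁ F N θ hP → (∀ P, w.up P = upOfRecord₅C F N (θ.view₁₁B10YZW F N Mstar ops ζ lam) P) → ∀ P : B12.RunParams,
        (P.K ≤ lam.kSel P →
          (repDataOfSel (repTOfRecord9 F N θ.ν θ.τ9 (EOfRecord₁₀ F N θ.toStage9Params) (wOfRecord₉ F N θ.toStage9Params) θ.ppSel P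
              (gOfRecord₁₀ F N θ.toStage9Params P) (lam.kSel P))
            (θ.ppSel P (gOfRecord₁₀ F N θ.toStage9Params P) (lam.kSel P + 1))
            (fibOfSeq F θ.ν θ.τ9 P (gOfRecord₁₀ F N θ.toStage9Params P) (lam.kSel P + 1))).ProvisosSupp) ∧
        lam.D1100 P
          = rPrimeDataOfSel (repTOfRecord9 F N θ.ν θ.τ9 (EOfRecord₁₀ F N θ.toStage9Params) (wOfRecord₉ F N θ.toStage9Params) θ.ppSel P
                (gOfRecord₁₀ F N θ.toStage9Params P) (lam.kSel P))
              (θ.ppSel P (gOfRecord₁₀ F N θ.toStage9Params P) (lam.kSel P + 1)) (fibOfSeq F θ.ν θ.τ9 P (gOfRecord₁₀ F N θ.toStage9Params P) (lam.kSel P + 1)) ∧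
        (∀ s, 0 < ∫ V, rterm (repTOfRecord9 F N θ.ν θ.τ9 (EOfRecord₁₀ F N θ.toStage9Params) (wOfRecord₉ F N θ.toStage9Params) θ.ppSel P
          (gOfRecord₁₀ F N θ.toStage9Params P) (lam.kSel P)) s V ∂(fieldMeasure (F.P P.K) (lam.kSel P + 1) (SU N))) ∧
        Prop1Printed (lam.LF P) ∧
        (∀ U, new189 (lam.D189 P) U → ∀ i, (lam.D189 P).h ≤ i → i ≤ (lam.D189 P).k → ∀ q ∈ plaqsOf (dom (lam.D189 P) i),
          Ineq180 ((lam.D189 P).dev0 U q) ((lam.D189 P).ε (lam.D189 P).k) (lam.D189 P).η (lam.D189 P).B₃ (lam.D189 P).B₅ (lam.D189 P).M (lam.D189 P).δ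
            ((lam.D189 P).dist q) (lam.D189 P).O1) ∧
        Claim189 (new189 (lam.D189 P)) (chiPP (lam.D189 P)))
    (P : B12.RunParams) : Dag.B15_main (leavesP w P) := by
  obtain ⟨θ, hP, Mstar, ops, ζ, lam, hθ, hD, -, -, -, hup⟩ := h
  obtain ⟨hdeg, hpin, hmass, hP1, h180, h189⟩ := hyp θ hP Mstar ops ζ lam hθ hD hup P
  have hd : WDisplays₁₀ θ.toStage9Params lam P := wDisplays₁₀_of_rPrimePin_deg hP.base hdeg hpin hmass hP1 h180 h189
  intro _ _ _ _ _
  show (w.up P).rBasicStep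
  rw [hup P]
  exact (upOfRecord₅C_view₁₁B10YZW_leaves F N θ Mstar ops ζ lam P).1.2 (b15Leaf_WOfRecord₁₀_of_displays hd)

/-- **A2 — the degenerate-run clause is SATISFIABLE and, below `K`, VOID**: for a run with `λ.kSel P < P.K` the clause `P.K ≤ λ.kSel P → …` holds vacuously, so on
Bałaban's tori (`K ≥ 1`, step below `K`) the repaired closers ask exactly what §3's did. [cite: Balaban1989LargeFieldI, (0.2) p.176 (bookkeeping)] -/
theorem deg_clause_of_lt {P : B12.RunParams} (hk : lam.kSel P < P.K) (X : Prop) : P.K ≤ lam.kSel P → X :=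
  fun h => absurd hk (not_lt.mpr h)

end Degenerate

end Literature.MathematicalPhysics.QuantumFieldTheory.Balaban1983to89.B15RPrime1100AtRecord

end
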